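import Summits.HodgeConjecture.HodgeConjecture.Theorems.NikulinTwinTransportTwinSimilitudeAlgebraicStubWittCompletionAux
import HarnessLib

/-!
# Route NikulinTwinTransport · crux X = `TwinSimilitudeAlgebraic` (stmt-HodgeConjecture-13674) —
# stub `stub_cmCayleyDecomposition` of line `hyperkaehler-nikulin-anchors` (reshape r11): the Cayley-transform
# decomposition of a `2`-similitude (pure linear algebra over `ℚ`)

Let `(V, B)` be a finite-dimensional non-degenerate symmetric `ℚ`-space, `J` a linear automorphism
with `B(Jx, Jy) = 2B(x, y)`, `N ≤ V` a `J`-stable subspace with `B|_N` non-degenerate, `T = N^⊥`,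
and suppose `J² − 2` is injective on `T`. Then `J = Σᵢ cᵢ qᵢ(J) + Σₗ B(·, aₗ) bₗ` with every
`qᵢ(J)` a `B`-isometry and `aₗ, bₗ ∈ N` (`stub_cmCayleyDecomposition`). Proof (Cayley transform
in the commutative algebra `ℚ[J]`): `J⁻¹`, hence the adjoint `J̄ = 2J⁻¹`, is a polynomial in `J`;
for `a ≠ 0` with `J̄ + a` invertible, `u_a = (J + a)(J̄ + a)⁻¹` and `u₀ = ½J²` are polynomial
isometries with `a J (u_a − 1) = J² − 2u_a = 2(u₀ − u_a)`. On `T` the map `g = u_a − 1` is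
injective (the hypothesis on `J² − 2`), so `g ∘ s(g) = 1` on `T` for a polynomial `s`, and on `T`
`J = P := a⁻¹ (J² − 2u_a) s(g)`, a `ℚ`-combination of the isometries `u₀ u_aⁱ`, `u_aⁱ⁺¹`;
`J − P` kills `T` and maps `V = N ⊕ T` into `N`, hence is a sum of rank-one maps `B(·, aₗ) bₗ`,
`aₗ, bₗ ∈ N` (`exists_eq_sum_rankOne₂`). Field-general helpers: `exists_mul_aeval_eq_one`
(polynomial inverse of an injective endomorphism), `exists_ne_zero_and_injective_add_algebraMap`
(`f + a` injective for some `a ≠ 0` over an infinite field), `apply_aeval_of_semiconj`,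
`coe_aeval_restrict`, `aeval_apply_mem` (polynomials along `f`-equivariant maps / `f`-stable
subspaces), `aeval_eq_aeval_of_sub_eq`. Stub worker of prover seat c6, line lead's skeleton r11.
-/

noncomputable section

set_option linter.dupNamespace false

open Polynomial

namespace Summit.HodgeConjecture.HodgeConjecture.Theorems.NikulinTwinTransport

section CayleyHelpers

variable {K : Type*} [Field K] {V : Type*} [AddCommGroup V] [Module K V]

/-- **An injective endomorphism of a finite-dimensional vector space has a polynomial inverse**:
the minimal polynomial `μ` of `f` has `μ(0) ≠ 0` (else `0` would be an eigenvalue), and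
`μ = X · μ.divX + μ(0)` gives `f ∘ (−μ(0)⁻¹ μ.divX)(f) = 1`. [folklore] -/
theorem exists_mul_aeval_eq_one [FiniteDimensional K V] {f : Module.End K V}
    (hf : Function.Injective f) : ∃ r : K[X], f * aeval f r = 1 := by
  have h0 : (minpoly K f).coeff 0 ≠ 0 := by
    intro h
    have hroot : (minpoly K f).IsRoot 0 := by
      rw [IsRoot.def, ← coeff_zero_eq_eval_zero, h]
    have hev : f.HasEigenvalue 0 := Module.End.hasEigenvalue_iff_isRoot.2 hroot
    exact (Module.End.hasEigenvalue_iff.1 hev)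
      (by rw [Module.End.eigenspace_zero, LinearMap.ker_eq_bot.2 hf])
  have key : f * aeval f (minpoly K f).divX + algebraMap K _ ((minpoly K f).coeff 0) = 0 := by
    have h := minpoly.aeval K f
    rw [← X_mul_divX_add (minpoly K f), map_add, map_mul, aeval_X, aeval_C] at h
    exact h
  refine ⟨C (-((minpoly K f).coeff 0)⁻¹) * (minpoly K f).divX, ?_⟩
  rw [map_mul, aeval_C, ← mul_assoc, ← Algebra.commutes, mul_assoc,
    eq_neg_of_add_eq_zero_left key, mul_neg, ← map_mul, ← map_neg, neg_mul, neg_neg,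
    inv_mul_cancel₀ h0, map_one]

/-- **Over an infinite field, `f + a` is injective for some scalar `a ≠ 0`**: the eigenvalues of
`f` form a finite set, so some `a ≠ 0` has `−a` outside it. [folklore] -/
theorem exists_ne_zero_and_injective_add_algebraMap [Infinite K] [FiniteDimensional K V]
    (f : Module.End K V) :
    ∃ a : K, a ≠ 0 ∧ Function.Injective (f + algebraMap K (Module.End K V) a) := by
  have hfin : Set.Finite (insert (0 : K) ((fun μ => -μ) '' {μ | f.HasEigenvalue μ})) :=
    (f.finite_hasEigenvalue.image _).insert 0
  obtain ⟨a, -, ha⟩ := Set.infinite_univ.exists_notMem_finite hfin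
  simp only [Set.mem_insert_iff, Set.mem_image, Set.mem_setOf_eq, not_or, not_exists,
    not_and] at ha
  refine ⟨a, ha.1, ?_⟩
  rw [← LinearMap.ker_eq_bot]
  by_contra hne
  refine ha.2 (-a) ?_ (neg_neg a)
  rw [Module.End.hasEigenvalue_iff]
  intro hbot
  apply hne
  rw [eq_bot_iff] at hbot ⊢
  intro x hx
  apply hbot
  rw [Module.End.mem_eigenspace_iff]
  rw [LinearMap.mem_ker, LinearMap.add_apply, Module.algebraMap_end_apply] at hx
  rw [neg_smul, eq_neg_iff_add_eq_zero, hx]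

/-- **Intertwining of polynomials**: if `i ∘ f' = f ∘ i` then `i ∘ p(f') = p(f) ∘ i` for every
polynomial `p`. [folklore] -/
theorem apply_aeval_of_semiconj {W : Type*} [AddCommGroup W] [Module K W] (i : W →ₗ[K] V)
    {f' : Module.End K W} {f : Module.End K V} (h : ∀ w, i (f' w) = f (i w)) (p : K[X]) :
    ∀ w, i (aeval f' p w) = aeval f p (i w) := by
  refine p.induction_on (fun c w => ?_) (fun p q hp hq w => ?_) (fun n c hn w => ?_)
  · simp only [aeval_C, Module.algebraMap_end_apply, map_smul]
  · simp only [map_add, LinearMap.add_apply, hp, hq]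
  · rw [pow_succ, ← mul_assoc, map_mul (aeval f'), map_mul (aeval f), aeval_X, aeval_X,
      Module.End.mul_apply, Module.End.mul_apply, hn, h]

/-- Polynomials in `f` commute with restriction to an `f`-stable subspace. [folklore] -/
theorem coe_aeval_restrict {p : Submodule K V} {f : Module.End K V} (hf : ∀ x ∈ p, f x ∈ p)
    (q : K[X]) (x : p) : ((aeval (f.restrict hf) q x : p) : V) = aeval f q (x : V) :=
  apply_aeval_of_semiconj p.subtype (f' := f.restrict hf) (f := f) (fun _ => rfl) q x

/-- An `f`-stable subspace is stable under every polynomial in `f`. [folklore] -/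
theorem aeval_apply_mem {p : Submodule K V} {f : Module.End K V} (hf : ∀ x ∈ p, f x ∈ p)
    (q : K[X]) {x : V} (hx : x ∈ p) : aeval f q x ∈ p := by
  rw [← coe_aeval_restrict hf q ⟨x, hx⟩]
  exact Submodule.coe_mem _

/-- **Evaluating congruent polynomials**: if `P − Q` lies in the ideal generated by two polynomials
killed by evaluation at `j`, then `P(j) = Q(j)`. [folklore] -/
theorem aeval_eq_aeval_of_sub_eq {A : Type*} [Ring A] [Algebra K A] (j : A) {e₁ e₂ P Q : K[X]}
    (h₁ : aeval j e₁ = 0) (h₂ : aeval j e₂ = 0) (S₁ S₂ : K[X])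
    (h : P - Q = S₁ * e₁ + S₂ * e₂) : aeval j P = aeval j Q := by
  rw [← sub_eq_zero, ← map_sub, h, map_add, map_mul, map_mul, h₁, h₂, mul_zero, mul_zero,
    add_zero]

end CayleyHelpers

/-- **Cayley-transform decomposition of a `2`-similitude.** For a finite-dimensional
non-degenerate symmetric `ℚ`-space `(V, B)`, a linear automorphism `J` with
`B(Jx, Jy) = 2B(x, y)`, a `J`-stable subspace `N` with `B|_N` non-degenerate and `J² − 2`
injective on `N^⊥`: `J = Σᵢ cᵢ qᵢ(J) + Σₗ B(·, aₗ) bₗ` with all `qᵢ(J)` isometries of `B` and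
`aₗ, bₗ ∈ N`. With `J̄ = 2J⁻¹` (the `B`-adjoint of `J`, a polynomial in `J`) and `a ≠ 0` such that
`J̄ + a` is invertible, the Cayley transforms `u_a = (J + a)(J̄ + a)⁻¹` and `u₀ = ½J²` are
polynomial isometries with `a J (u_a − 1) = J² − 2u_a`; `g = u_a − 1` is injective on the
`ℚ[J]`-stable `T = N^⊥`, so `g ∘ s(g) = 1` on `T` for a polynomial `s`, whence
`J|_T = a⁻¹ (J² − 2u_a) s(g)|_T` is a combination of the isometries `u₀ u_aⁱ`, `u_aⁱ⁺¹`; the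
difference `J − P` kills `T`, maps `V = N ⊕ T` into `N`, and is therefore a sum of rank-one maps
`B(·, aₗ) bₗ`, `aₗ, bₗ ∈ N`. [cite: Huybrechts2019, §1] [cite: Buskin2019, §6.2] -/
theorem stub_cmCayleyDecomposition :
    ∀ (V : Type) [AddCommGroup V] [Module ℚ V] [FiniteDimensional ℚ V]
      (B : LinearMap.BilinForm ℚ V), B.IsSymm → B.Nondegenerate →
      ∀ (J : V ≃ₗ[ℚ] V), (∀ x y, B (J x) (J y) = 2 * B x y) →
      ∀ (N : Submodule ℚ V), (B.restrict N).Nondegenerate → (∀ u ∈ N, J u ∈ N) →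
      (∀ w ∈ B.orthogonal N, J (J w) = (2 : ℚ) • w → w = 0) →
      ∃ (m : ℕ) (c : Fin m → ℚ) (q : Fin m → Polynomial ℚ) (k : ℕ) (a b : Fin k → V),
        (∀ i x y, B (Polynomial.aeval J.toLinearMap (q i) x) (Polynomial.aeval J.toLinearMap (q i) y) = B x y) ∧
        (∀ l, a l ∈ N) ∧ (∀ l, b l ∈ N) ∧
        ∀ x, J x = ∑ i, c i • Polynomial.aeval J.toLinearMap (q i) x + ∑ l, B x (a l) • b l := by
  intro V _ _ _ B hB hBn J hJ N hN hJN hT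
  classical
  have hBr : B.IsRefl := hB.isRefl
  set j : Module.End ℚ V := J.toLinearMap with hj
  have hjx : ∀ x, j x = J x := fun x => rfl
  -- basic identities for the `2`-similitude `J`
  have F2 : ∀ x y, B (J.symm x) (J.symm y) = (1 / 2 : ℚ) * B x y := by
    intro x y
    have h := hJ (J.symm x) (J.symm y)
    rw [J.apply_symm_apply, J.apply_symm_apply] at h
    rw [h]; ring
  have F3 : ∀ x y, B (J x) y = 2 * B x (J.symm y) := by
    intro x y
    have h := hJ x (J.symm y)
    rwa [J.apply_symm_apply] at h
  have F4 : ∀ x y, B x (J y) = 2 * B (J.symm x) y := by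
    intro x y
    have h := hJ (J.symm x) y
    rwa [J.apply_symm_apply] at h
  -- `V = N ⊕ T`, `T = N^⊥`; `J` maps `N` onto `N`, hence `T` into `T`
  have hc : IsCompl N (B.orthogonal N) :=
    (LinearMap.BilinForm.restrict_nondegenerate_iff_isCompl_orthogonal hBr).1 hN
  have hJNsurj : ∀ n ∈ N, ∃ n' ∈ N, J n' = n := by
    intro n hn
    have hinj : Function.Injective (j.restrict hJN) := by
      intro x y hxy
      apply Subtype.ext
      apply J.injective
      have h := congrArg Subtype.val hxy
      rwa [LinearMap.coe_restrict_apply, LinearMap.coe_restrict_apply] at h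
    obtain ⟨⟨n', hn'⟩, h⟩ := LinearMap.injective_iff_surjective.1 hinj ⟨n, hn⟩
    refine ⟨n', hn', ?_⟩
    rw [← hjx]
    exact congrArg Subtype.val h
  have hJT : ∀ t ∈ B.orthogonal N, j t ∈ B.orthogonal N := by
    intro t ht
    rw [LinearMap.BilinForm.mem_orthogonal_iff] at ht ⊢
    intro n hn
    obtain ⟨n', hn', rfl⟩ := hJNsurj n hn
    rw [hjx, hJ, ht n' hn', mul_zero]
  -- (1) `J⁻¹` is a polynomial `r₁(J)`
  obtain ⟨r₁, hr₁'⟩ := exists_mul_aeval_eq_one (f := j) J.injective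
  have hr₁ : ∀ x, aeval j r₁ x = J.symm x := fun x => by
    have h := LinearMap.congr_fun hr₁' x
    rw [Module.End.mul_apply, Module.End.one_apply, hjx] at h
    conv_rhs => rw [← h]
    rw [J.symm_apply_apply]
  have he₁ : aeval j (X * r₁ - 1) = 0 := by
    rw [map_sub, map_mul, aeval_X, hr₁', map_one, sub_self]
  -- (2) a scalar `a ≠ 0` with `w(J) = J̄ + a = 2J⁻¹ + a` injective
  obtain ⟨a, ha0, hainj⟩ := exists_ne_zero_and_injective_add_algebraMap (aeval j (C 2 * r₁))
  obtain ⟨w, hw⟩ : ∃ w : ℚ[X], w = C 2 * r₁ + C a := ⟨_, rfl⟩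
  have hwinj : Function.Injective (aeval j w) := by
    rw [hw, map_add, aeval_C]; exact hainj
  have hw_apply : ∀ x, aeval j w x = (2 : ℚ) • J.symm x + a • x := fun x => by
    simp only [hw, map_add, map_mul, aeval_C, Module.End.mul_apply, Module.algebraMap_end_apply,
      LinearMap.add_apply, hr₁]
  -- (3) `(J̄ + a)⁻¹` is a polynomial `r₂(J)`
  obtain ⟨r₂', hr₂'⟩ := exists_mul_aeval_eq_one hwinj
  obtain ⟨r₂, hr₂def⟩ : ∃ r₂ : ℚ[X], r₂ = r₂'.comp w := ⟨_, rfl⟩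
  have hr₂ : aeval j (w * r₂) = 1 := by rw [map_mul, hr₂def, aeval_comp, hr₂']
  have he₂ : aeval j (w * r₂ - 1) = 0 := by rw [map_sub, hr₂, map_one, sub_self]
  have hwr₂ : ∀ x, aeval j w (aeval j r₂ x) = x := fun x => by
    rw [← Module.End.mul_apply, ← map_mul, hr₂, Module.End.one_apply]
  -- the Cayley transforms `u₀ = ½ J²`, `u_a = (J + a) r₂(J)` and `g = u_a − 1`
  obtain ⟨u0, hu0⟩ : ∃ u0 : ℚ[X], u0 = C (1 / 2 : ℚ) * X ^ 2 := ⟨_, rfl⟩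
  obtain ⟨ua, hua⟩ : ∃ ua : ℚ[X], ua = (X + C a) * r₂ := ⟨_, rfl⟩
  obtain ⟨gp, hgp⟩ : ∃ gp : ℚ[X], gp = ua - 1 := ⟨_, rfl⟩
  have hu0_apply : ∀ x, aeval j u0 x = (1 / 2 : ℚ) • J (J x) := fun x => by
    simp only [hu0, map_mul, aeval_C, aeval_X, Module.End.mul_apply,
      Module.algebraMap_end_apply, pow_two, hjx]
  have hua_apply : ∀ x, aeval j ua x = J (aeval j r₂ x) + a • aeval j r₂ x := fun x => by
    simp only [hua, map_mul, map_add, aeval_C, aeval_X, Module.End.mul_apply, LinearMap.add_apply,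
      Module.algebraMap_end_apply, hjx]
  -- (4) they are isometries
  have hu0_iso : ∀ x y, B (aeval j u0 x) (aeval j u0 y) = B x y := fun x y => by
    rw [hu0_apply, hu0_apply]
    simp only [map_smul, LinearMap.smul_apply, smul_eq_mul]
    rw [hJ, hJ]
    ring
  have hua_iso : ∀ x y, B (aeval j ua x) (aeval j ua y) = B x y := fun x y => by
    have key : ∀ x' y', B (J x' + a • x') (J y' + a • y') =
        B ((2 : ℚ) • J.symm x' + a • x') ((2 : ℚ) • J.symm y' + a • y') := by
      intro x' y'
      simp only [map_add, map_smul, LinearMap.add_apply, LinearMap.smul_apply, smul_eq_mul]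
      rw [hJ, F3, F4, F2]
      ring
    rw [hua_apply, hua_apply, key]
    conv_rhs => rw [← hwr₂ x, ← hwr₂ y, hw_apply, hw_apply]
  -- (5) the key identity `a J g = J² − 2 u_a`, and `g = (J − J̄) r₂(J)`
  have hk : aeval j (C a * X * gp) = aeval j (X ^ 2 - C 2 * ua) :=
    aeval_eq_aeval_of_sub_eq j he₁ he₂ (-(C 2 * (X + C a) * r₂)) (X * (X + C a))
      (by rw [hgp, hua, hw]; ring)
  have hg_eq : aeval j gp = aeval j ((X - C 2 * r₁) * r₂) :=
    aeval_eq_aeval_of_sub_eq j he₁ he₂ 0 1 (by rw [hgp, hua, hw]; ring)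
  have hg_apply : ∀ x, aeval j gp x = J (aeval j r₂ x) - (2 : ℚ) • J.symm (aeval j r₂ x) :=
    fun x => by
    rw [hg_eq]
    simp only [map_mul, map_sub, aeval_C, aeval_X, Module.End.mul_apply, LinearMap.sub_apply,
      Module.algebraMap_end_apply, hr₁, hjx]
  -- (6)/(7) `T` is `ℚ[J]`-stable and `g` is injective on `T`
  have hginj : ∀ t ∈ B.orthogonal N, aeval j gp t = 0 → t = 0 := by
    intro t ht h0
    rw [hg_apply, sub_eq_zero] at h0
    have h1 : J (J (aeval j r₂ t)) = (2 : ℚ) • aeval j r₂ t := by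
      rw [h0, map_smul, J.apply_symm_apply]
    have h2 : aeval j r₂ t = 0 := hT _ (aeval_apply_mem hJT r₂ ht) h1
    rw [← hwr₂ t, h2, map_zero]
  have hgT : ∀ t ∈ B.orthogonal N, aeval j gp t ∈ B.orthogonal N :=
    fun t ht => aeval_apply_mem hJT gp ht
  have hgTinj : Function.Injective ((aeval j gp).restrict hgT) := by
    rw [← LinearMap.ker_eq_bot, LinearMap.ker_eq_bot']
    rintro ⟨t, ht⟩ h0
    exact Subtype.ext (hginj t ht (congrArg Subtype.val h0))
  -- (8) a polynomial `s` with `g ∘ s(g) = 1` on `T`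
  obtain ⟨s, hs⟩ := exists_mul_aeval_eq_one hgTinj
  have hσ : ∀ t ∈ B.orthogonal N, aeval j gp (aeval j (s.comp gp) t) = t := by
    intro t ht
    have h := congrArg Subtype.val (LinearMap.congr_fun hs ⟨t, ht⟩)
    rw [Module.End.mul_apply, Module.End.one_apply, LinearMap.coe_restrict_apply,
      coe_aeval_restrict] at h
    rw [aeval_comp]
    exact h
  -- (9) the polynomial part `P = a⁻¹ (J² − 2u_a) s(g)` agrees with `J` on `T`
  obtain ⟨P, hP⟩ : ∃ P : Module.End ℚ V, P = a⁻¹ • aeval j ((X ^ 2 - C 2 * ua) * s.comp gp) :=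
    ⟨_, rfl⟩
  have hPN : ∀ n ∈ N, P n ∈ N := fun n hn => by
    rw [hP, LinearMap.smul_apply]
    exact N.smul_mem _ (aeval_apply_mem hJN _ hn)
  have hPT : ∀ t ∈ B.orthogonal N, P t = J t := by
    intro t ht
    have h1 : a • (j * aeval j gp) = aeval j (X ^ 2 - C 2 * ua) := by
      rw [← hk, map_mul, map_mul, aeval_C, aeval_X, Algebra.smul_def, mul_assoc]
    rw [hP, map_mul, ← h1, LinearMap.smul_apply, Module.End.mul_apply, LinearMap.smul_apply,
      smul_smul, inv_mul_cancel₀ ha0, one_smul, Module.End.mul_apply, hσ t ht, hjx]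
  -- (10) the difference `D = J − P` kills `T` and maps `V` into `N`: rank-one expansion
  obtain ⟨D, hD⟩ : ∃ D : Module.End ℚ V, D = j - P := ⟨_, rfl⟩
  have hDT : ∀ t ∈ B.orthogonal N, D t = 0 := fun t ht => by
    rw [hD, LinearMap.sub_apply, hPT t ht, hjx, sub_self]
  have hDN : ∀ x, D x ∈ N := fun x => by
    have hx : x ∈ N ⊔ B.orthogonal N := by rw [hc.sup_eq_top]; exact Submodule.mem_top
    obtain ⟨n, hn, t, ht, rfl⟩ := Submodule.mem_sup.1 hx
    rw [map_add, hDT t ht, add_zero, hD, LinearMap.sub_apply, hjx]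
    exact N.sub_mem (hJN n hn) (hPN n hn)
  obtain ⟨k, av, bv, hav, hbv, hDsum⟩ := exists_eq_sum_rankOne₂ hB hBn N N D hDN hDT
  -- (11) `P` lies in the `ℚ`-span of the polynomial isometries
  obtain ⟨Iso, hIso⟩ : ∃ Iso : Set (Module.End ℚ V), ∀ f, f ∈ Iso ↔
      (∃ q : ℚ[X], aeval j q = f) ∧ ∀ x y, B (f x) (f y) = B x y :=
    ⟨{f | (∃ q : ℚ[X], aeval j q = f) ∧ ∀ x y, B (f x) (f y) = B x y}, fun f => Iff.rfl⟩
  have hIso_mul : ∀ f ∈ Iso, ∀ f' ∈ Iso, f * f' ∈ Iso := by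
    intro f hf f' hf'
    rw [hIso] at hf hf' ⊢
    obtain ⟨⟨q, rfl⟩, hf⟩ := hf
    obtain ⟨⟨q', rfl⟩, hf'⟩ := hf'
    exact ⟨⟨q * q', map_mul _ _ _⟩, fun x y => by
      rw [Module.End.mul_apply, Module.End.mul_apply, hf, hf']⟩
  have hIso_pow : ∀ f ∈ Iso, ∀ n : ℕ, f ^ n ∈ Iso := by
    intro f hf n
    induction n with
    | zero =>
      rw [pow_zero, hIso]
      exact ⟨⟨1, map_one _⟩, fun x y => rfl⟩
    | succ n ih => rw [pow_succ]; exact hIso_mul _ ih _ hf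
  have hu0I : aeval j u0 ∈ Iso := (hIso _).2 ⟨⟨u0, rfl⟩, hu0_iso⟩
  have huaI : aeval j ua ∈ Iso := (hIso _).2 ⟨⟨ua, rfl⟩, hua_iso⟩
  have hSmul : ∀ f ∈ Iso, ∀ Q ∈ Submodule.span ℚ Iso, f * Q ∈ Submodule.span ℚ Iso := by
    intro f hf Q hQ
    induction hQ using Submodule.span_induction with
    | mem x hx => exact Submodule.subset_span (hIso_mul f hf x hx)
    | zero => rw [mul_zero]; exact Submodule.zero_mem _
    | add x y _ _ hx hy => rw [mul_add]; exact Submodule.add_mem _ hx hy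
    | smul c x _ hx => rw [mul_smul_comm]; exact Submodule.smul_mem _ c hx
  have hPS : P ∈ Submodule.span ℚ Iso := by
    have h2 : aeval j (s.comp gp) = aeval (aeval j ua) (s.comp (X - C 1)) := by
      rw [aeval_comp, aeval_comp, map_sub, aeval_X, aeval_C, map_one, hgp, map_sub, map_one]
    have hX2 : aeval j (X ^ 2 - C 2 * ua) = (2 : ℚ) • (aeval j u0 - aeval j ua) := by
      rw [hu0, map_sub, map_mul, map_mul, map_pow, aeval_C, aeval_C, aeval_X, ← Algebra.smul_def,
        ← Algebra.smul_def, smul_sub, smul_smul]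
      norm_num
    have hσS : aeval (aeval j ua) (s.comp (X - C 1)) ∈ Submodule.span ℚ Iso := by
      rw [aeval_eq_sum_range]
      exact Submodule.sum_mem _ fun i _ =>
        Submodule.smul_mem _ _ (Submodule.subset_span (hIso_pow _ huaI i))
    rw [hP, map_mul, h2, hX2, smul_mul_assoc, sub_mul]
    exact Submodule.smul_mem _ _ (Submodule.smul_mem _ _
      (Submodule.sub_mem _ (hSmul _ hu0I _ hσS) (hSmul _ huaI _ hσS)))
  -- (12) assemble
  obtain ⟨m, c, q', hq'⟩ := Submodule.mem_span_set'.1 hPS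
  choose q hq using fun i => ((hIso _).1 (q' i).2).1
  refine ⟨m, c, q, k, av, bv, fun i x y => ?_, hav, hbv, fun x => ?_⟩
  · rw [hq i]
    exact ((hIso _).1 (q' i).2).2 x y
  · have hx : J x = P x + D x := by rw [hD, LinearMap.sub_apply, hjx]; abel
    rw [hx, hDsum x, ← hq', LinearMap.sum_apply]
    simp only [LinearMap.smul_apply, hq]

end Summit.HodgeConjecture.HodgeConjecture.Theorems.NikulinTwinTransport

end
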